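import Mathlib
import Summits.Ventures.PercRepro2.Defs
import Summits.Ventures.PercRepro2.Graph
import Summits.Ventures.PercRepro2.OneColourSwitch
import Summits.Ventures.PercRepro2.RegionHubSign
import Summits.Ventures.PercRepro2.SideSwitch
import Summits.Ventures.PercRepro2.SideSwitchM9
import Summits.Ventures.PercRepro2.SideSwitchClosed
import Summits.Ventures.PercRepro2.SideSwitchComps
import Summits.Ventures.PercRepro2.SideSwitchFibre
import Summits.Ventures.PercRepro2.TermSwitchDefs
import Summits.Ventures.PercRepro2.TermSwitchFibre
import Summits.Ventures.PercRepro2.TermSwitchCompsFibre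
import Summits.Ventures.PercRepro2.TermSwitchMono
import Summits.Ventures.PercRepro2.TermSwitchM9
import Summits.Ventures.PercRepro2.TermSwitchReach
import Summits.Ventures.PercRepro2.TermSwitchRestrict
import Summits.Ventures.PercRepro2.M9ReachedSum
import Summits.Ventures.PercRepro2.M9CornerHarris
import Summits.Ventures.PercRepro2.M9OneSidedFibre
import Summits.Ventures.PercRepro2.M9OneSidedFibreM

/-!
# The one-sided fibre sum of a `T`-free representative is non-positive (blind cell PercRepro2,
p3 g30, 2026-08-28; `proofs/P3-HDR.md` §10(c))

With `M9OneSidedFibre` / `M9OneSidedFibreM` the one-sided points of a three-terminal fibre are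
exactly the corner pair of the joining blocks `J` (`oneSided_assignC_iff_corners`: `J ≠ ∅` and
`T ∈ corners (compsH ρ) J`), a set symmetric under `T ↦ compsH ∖ T`, so the Harris step on
the corner pair (`M9CornerHarris`) bounds the paired fibre sum
`Σ_{T ∈ corners} (σ_pq(ρ_T) + σ_pq(ρ^O_T)) · σ_rs(ρ_T) ≤ 0` (`corner_fibre_sum_nonpos`), with
`D(T) = G(T) − G(A ∖ T)` increasing and `σ_rs` decreasing exactly as in the lane's
`fibre_sum_nonpos`.  Own work; std axioms.
-/

namespace Summit.Ventures.PercRepro2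

namespace TermSwitch

open Finset Classical RegionHub OneColourSwitch SideSwitch

variable {V : Type*} {E : Type*}

section Corner

variable [Fintype V] [DecidableEq V] [Fintype E] [DecidableEq E] {ends : E → Sym2 V} {p q r s d : V}

omit [Fintype E] [DecidableEq E] in
/-- **The one-sided points of the fibre are the corner pair of the joining blocks.** -/
theorem oneSided_assignC_iff_corners (hT : TFree ends r s d) {ρ : Config E}
    (hρ : ∀ x ∈ MH ends ({r, s, d} : Set V) ρ, x ∈ ({r, s, d} : Set V))
    {T : Finset (Finset V)} (hTc : T ⊆ compsH ends ({r, s, d} : Set V) ρ) :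
    NoPocket.OneSided ends r s d (assignC ends T ρ) ↔
      (joinSet ends r s d ρ).Nonempty ∧
        T ∈ corners (compsH ends ({r, s, d} : Set V) ρ) (joinSet ends r s d ρ) := by
  rw [NoPocket.OneSided, mem_K2_assignC_iff_joins hT hρ hTc, mem_M2_assignC_iff_joins hT hρ hTc]
  have hK : (∃ B ∈ compsH ends ({r, s, d} : Set V) ρ, B ∉ T ∧ joinsB ends r s d B ρ) ↔
      ¬ joinSet ends r s d ρ ⊆ T := by
    constructor
    · rintro ⟨B, hB, hBT, hj⟩ hsub
      exact hBT (hsub (Finset.mem_filter.2 ⟨hB, hj⟩))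
    · intro h
      rw [Finset.not_subset] at h
      obtain ⟨B, hB, hBT⟩ := h
      exact ⟨B, (Finset.mem_filter.1 hB).1, hBT, (Finset.mem_filter.1 hB).2⟩
  have hM : (∃ B ∈ T, joinsB ends r s d B ρ) ↔ (joinSet ends r s d ρ ∩ T).Nonempty := by
    constructor
    · rintro ⟨B, hBT, hj⟩
      exact ⟨B, Finset.mem_inter.2 ⟨Finset.mem_filter.2 ⟨hTc hBT, hj⟩, hBT⟩⟩
    · rintro ⟨B, hB⟩
      obtain ⟨hBJ, hBT⟩ := Finset.mem_inter.1 hB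
      exact ⟨B, hBT, (Finset.mem_filter.1 hBJ).2⟩
  rw [hK, hM]
  simp only [corners, Finset.mem_filter, Finset.mem_powerset]
  constructor
  · rintro ⟨h1, h2⟩
    by_cases hsub : joinSet ends r s d ρ ⊆ T
    · have hne : (joinSet ends r s d ρ ∩ T).Nonempty := by
        rcases h1 with h | h
        · exact absurd hsub h
        · exact h
      refine ⟨?_, hTc, Or.inr hsub⟩
      obtain ⟨B, hB⟩ := hne
      exact ⟨B, (Finset.mem_inter.1 hB).1⟩
    · have hemp : ¬ (joinSet ends r s d ρ ∩ T).Nonempty := fun h => h2 ⟨hsub, h⟩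
      rw [Finset.not_nonempty_iff_eq_empty] at hemp
      refine ⟨?_, hTc, Or.inl hemp⟩
      rw [Finset.not_subset] at hsub
      obtain ⟨B, hB, _⟩ := hsub
      exact ⟨B, hB⟩
  · rintro ⟨hne, _, h⟩
    rcases h with h | h
    · have hsub : ¬ joinSet ends r s d ρ ⊆ T := by
        intro hsub
        obtain ⟨B, hB⟩ := hne
        have : B ∈ joinSet ends r s d ρ ∩ T := Finset.mem_inter.2 ⟨hB, hsub hB⟩
        rw [h] at this
        exact Finset.notMem_empty B this
      refine ⟨Or.inl hsub, fun h' => ?_⟩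
      obtain ⟨B, hB⟩ := h'.2
      rw [h] at hB
      exact Finset.notMem_empty B hB
    · have hne' : (joinSet ends r s d ρ ∩ T).Nonempty := by
        obtain ⟨B, hB⟩ := hne
        exact ⟨B, Finset.mem_inter.2 ⟨hB, h hB⟩⟩
      exact ⟨Or.inr hne', fun h' => h'.1 h⟩

omit [Fintype V] [Fintype E] [DecidableEq E] in
/-- The corner pair is symmetric under the complement. -/
lemma sdiff_mem_corners {A F T : Finset (Finset V)} (hFA : F ⊆ A) (hT : T ∈ corners A F) :
    A \ T ∈ corners A F := by
  obtain ⟨hTA, h⟩ := Finset.mem_filter.1 hT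
  rw [Finset.mem_powerset] at hTA
  refine Finset.mem_filter.2 ⟨Finset.mem_powerset.2 Finset.sdiff_subset, ?_⟩
  rcases h with h | h
  · right
    intro B hB
    exact Finset.mem_sdiff.2 ⟨hFA hB, fun hBT => by
      have : B ∈ F ∩ T := Finset.mem_inter.2 ⟨hB, hBT⟩
      rw [h] at this; exact Finset.notMem_empty B this⟩
  · left
    ext B
    simp only [Finset.mem_inter, Finset.mem_sdiff, Finset.notMem_empty, iff_false, not_and, not_not]
    intro hB _
    exact h hB

omit [Fintype V] [Fintype E] [DecidableEq E] in
/-- A sum over the corner pair is invariant under the complement. -/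
lemma sum_corners_sdiff {A F : Finset (Finset V)} (hFA : F ⊆ A) (g : Finset (Finset V) → ℤ) :
    ∑ T ∈ corners A F, g (A \ T) = ∑ T ∈ corners A F, g T := by
  refine Finset.sum_nbij' (fun T => A \ T) (fun T => A \ T) (fun T hT => sdiff_mem_corners hFA hT)
    (fun T hT => sdiff_mem_corners hFA hT) ?_ ?_ (fun T _ => rfl)
  · intro T hT
    exact Finset.sdiff_sdiff_eq_self (Finset.mem_powerset.1 (Finset.mem_filter.1 hT).1)
  · intro T hT
    exact Finset.sdiff_sdiff_eq_self (Finset.mem_powerset.1 (Finset.mem_filter.1 hT).1)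

/-- **The paired fibre sum over the corner pair of the joining blocks is non-positive.** -/
theorem corner_fibre_sum_nonpos {H : Set V} {ρ : Config E} (hρ : ρ ∈ RepH ends p q H)
    (hr : r ∈ H) (s : V) {F : Finset (Finset V)} (hFA : F ⊆ compsH ends H ρ) (hF : F.Nonempty) :
    ∑ T ∈ corners (compsH ends H ρ) F,
      (sigma ends (assignC ends T ρ) p q + sigma ends (assignC ends T (flipOH ends H ρ)) p q) *
        sigma ends (assignC ends T ρ) r s ≤ 0 := by
  set A := compsH ends H ρ with hA
  let Yc : Finset (Finset V) → ℤ := fun T => if Conn ends (assignC ends T ρ) p q then 1 else 0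
  let Yc' : Finset (Finset V) → ℤ := fun T =>
    if Conn ends (assignC ends T (flipOH ends H ρ)) p q then 1 else 0
  let G : Finset (Finset V) → ℤ := fun T => Yc T + Yc' T
  let D : Finset (Finset V) → ℤ := fun T => G T - G (A \ T)
  let S : Finset (Finset V) → ℤ := fun T => sigma ends (assignC ends T ρ) r s
  have hρO := flipOH_mem_RepH hρ
  have hmonoYc : ∀ T T', T ⊆ T' → T' ⊆ A → Yc T ≤ Yc T' := by
    intro T T' hTT hT'
    exact ite_le_ite_of_imp (conn_pq_assignC_mono_H hρ hTT hT')
  have hmonoYc' : ∀ T T', T ⊆ T' → T' ⊆ A → Yc' T ≤ Yc' T' := by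
    intro T T' hTT hT'
    have hT'O : T' ⊆ compsH ends H (flipOH ends H ρ) := by rw [compsH_flipOH]; exact hT'
    exact ite_le_ite_of_imp (conn_pq_assignC_mono_H hρO hTT hT'O)
  have hmonoD : ∀ T T', T ⊆ T' → T' ⊆ A → D T ≤ D T' := by
    intro T T' hTT hT'
    have h1 := hmonoYc T T' hTT hT'
    have h2 := hmonoYc' T T' hTT hT'
    have h3 := hmonoYc (A \ T') (A \ T) (Finset.sdiff_subset_sdiff (Finset.Subset.refl A) hTT)
      Finset.sdiff_subset
    have h4 := hmonoYc' (A \ T') (A \ T) (Finset.sdiff_subset_sdiff (Finset.Subset.refl A) hTT)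
      Finset.sdiff_subset
    simp only [D, G]
    linarith
  have hantiS : ∀ T T', T ⊆ T' → T' ⊆ A → S T' ≤ S T := by
    intro T T' hTT hT'
    show sigma ends (assignC ends T' ρ) r s ≤ sigma ends (assignC ends T ρ) r s
    unfold sigma
    exact sub_le_sub (ite_le_ite_of_imp (conn_rs_assignC_anti_H hρ hr s hTT hT'))
      (ite_le_ite_of_imp (conn_rs_compl_assignC_mono_H hρ hr s hTT hT'))
  have h0 : ∑ T ∈ corners A F, D T = 0 := by
    simp only [D]
    rw [Finset.sum_sub_distrib, sum_corners_sdiff hFA, sub_self]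
  have hH := sum_corners_mul_nonpos A F hFA hF D S hmonoD hantiS h0
  refine le_trans (le_of_eq ?_) hH
  refine Finset.sum_congr rfl (fun T hT => ?_)
  have hTA : T ⊆ A := Finset.mem_powerset.1 (Finset.mem_filter.1 hT).1
  rw [sigma_pq_add_flipOH_C hρ hTA]

end Corner

end TermSwitch

end Summit.Ventures.PercRepro2
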